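import Mathlib

/-!
# TRANSFER DESIGNS — the transfer recurrence, kernel form (crux 24318 (c) `LongMassSlowLawInv`; val-idea-31 g7)

Crux workfile of `Ideas/power-sieve.md` rev 4 §I / `MEMO-idea31-g7-transfer-family.md` §2, §5.6.  VP ≠ VNP is NOT proved;
24318 / S3 / (c) are OPEN; nothing here is a law or prices the crux.  What IS proved (0 sorries, general commutative ring `R`,
abstract 3-level frame):

Let `σ` carry a 3-LEVEL FRAME `F` (inclusions `Jᵢ : Matrix σ ιᵢ R`, projections `πᵢ : Matrix ιᵢ σ R`, `Σ Jᵢ πᵢ = 1`, `π₂ J₂ = 1`)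
and let `M : Matrix σ σ R` be a TRANSFER MATRIX for `(F, l, P, Q)` (`IsTransfer`): block pattern

      `M = [[0, X, C], [l•P, D, Y], [0, −l•Q, 0]]`      (`X = π₁ M J₂`, `C = π₁ M J₃`, `D = π₂ M J₂`, `Y = π₂ M J₃` arbitrary).

* ★ `G_rec` — the LOOP RETURNS `G L := π₂ M^L J₂` obey the TRANSFER RECURRENCE
      `G (L+3) = D·G (L+2) + l•(P X − Y Q)·G (L+1) − l²•(P C Q)·G L`,  `G 0 = 1`, `G 1 = D`, `G 2 = D² + l•(P X − Y Q)`: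
  the free block `X` enters only through the letter `N := P X − Y Q` (the Mathes–Omladič–Radjavi tie, generalised).
* ★ `G_mem` — every `G L` lies in any subalgebra containing the three letters `D`, `N`, `P C Q`.
* ★ `G_raised` / `G_eq_zero` — if the letters are STRICTLY block-upper for a level function `b : ι₂ → ℕ` with `b < T`
  (`Raised b 1`), then `G L` is raised by `⌊L/3⌋` levels, so `G L = 0` for `L ≥ 3T`;
* ★★ `pow_eq_zero` — hence `M ^ (3T + 4) = 0`: EVERY transfer matrix whose loop letters lie in a nilpotent flag algebra is nilpotent
  (all members of a transfer design `𝒲(P,Q,𝔫)` at once — the paper proof of MEMO §2, for all sizes `b`);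
* ★ `G_blockTriangular` — if the letters are weakly block-upper (`BlockTriangular · b`), so is every `G L`
  (the hypothesis the (c)-certificate of MEMO §5.6 feeds into row r8 ✓ `ResolventFlag.relCert_of_twist_pow_eq_zero`).

Instantiation for the census legs (`ι(8) ≥ 17`, `ι(9) ≥ 23`, MEMO §1) = an explicit frame on `Fin 2 ⊕ Fin k ⊕ Fin 2 ≃ Fin (k+4)` plus
five block identities of the generic member; irreducibility is row r10 (strong connectivity) and is not treated here.
-/

set_option linter.dupNamespace false

namespace Summit.ValiantsHypothesis.ValiantsHypothesis.Cruxes.DualUnipotentThreeHalves.TransferDesign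

open Matrix

variable {R : Type*} [CommRing R]
variable {σ ι₁ ι₂ ι₃ : Type*} [Fintype σ] [Fintype ι₁] [Fintype ι₂] [Fintype ι₃] [DecidableEq σ] [DecidableEq ι₂]

/-- A 3-LEVEL FRAME of the index type `σ`: inclusions `Jᵢ` and projections `πᵢ` of three levels with `Σ Jᵢ πᵢ = 1` and `π₂ J₂ = 1`
(e.g. the coordinate blocks of `σ = ι₁ ⊕ ι₂ ⊕ ι₃`; any conjugate frame works as well). -/
structure Frame (R : Type*) [CommRing R] (σ ι₁ ι₂ ι₃ : Type*) [Fintype σ] [Fintype ι₁] [Fintype ι₂] [Fintype ι₃]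
    [DecidableEq σ] [DecidableEq ι₂] where
  /-- inclusion of level 1 -/
  J₁ : Matrix σ ι₁ R
  /-- inclusion of level 2 (the loop level) -/
  J₂ : Matrix σ ι₂ R
  /-- inclusion of level 3 -/
  J₃ : Matrix σ ι₃ R
  /-- projection onto level 1 -/
  π₁ : Matrix ι₁ σ R
  /-- projection onto level 2 -/
  π₂ : Matrix ι₂ σ R
  /-- projection onto level 3 -/
  π₃ : Matrix ι₃ σ R
  /-- the three levels exhaust `σ` -/
  sum_eq : J₁ * π₁ + J₂ * π₂ + J₃ * π₃ = 1
  /-- `π₂` is a retraction of `J₂` -/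
  π₂_J₂ : π₂ * J₂ = 1

namespace Frame

variable (F : Frame R σ ι₁ ι₂ ι₃) (M : Matrix σ σ R)

/-- block `(1,2)` of `M`: the free "exit" block `X`. -/
def X : Matrix ι₁ ι₂ R := F.π₁ * M * F.J₂
/-- block `(1,3)` of `M`: the corner block `C`. -/
def C : Matrix ι₁ ι₃ R := F.π₁ * M * F.J₃
/-- block `(2,2)` of `M`: the loop letter `D`. -/
def D : Matrix ι₂ ι₂ R := F.π₂ * M * F.J₂
/-- block `(2,3)` of `M`: the "re-entry" block `Y`. -/
def Y : Matrix ι₂ ι₃ R := F.π₂ * M * F.J₃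
/-- LOOP RETURN of order `L`: block `(2,2)` of `M^L`. -/
def G (L : ℕ) : Matrix ι₂ ι₂ R := F.π₂ * M ^ L * F.J₂
/-- block `(1,2)` of `M^L`. -/
def U (L : ℕ) : Matrix ι₁ ι₂ R := F.π₁ * M ^ L * F.J₂
/-- block `(3,2)` of `M^L`. -/
def W (L : ℕ) : Matrix ι₃ ι₂ R := F.π₃ * M ^ L * F.J₂

/-- One step on the left: `p·M^{L+1}·q = Σᵢ (p M Jᵢ)(πᵢ M^L q)`. -/
theorem step_left {κ τ : Type*} (p : Matrix κ σ R) (q : Matrix σ τ R) (L : ℕ) :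
    p * M ^ (L + 1) * q = p * M * F.J₁ * (F.π₁ * M ^ L * q) + p * M * F.J₂ * (F.π₂ * M ^ L * q)
      + p * M * F.J₃ * (F.π₃ * M ^ L * q) := by
  have h : M ^ (L + 1) = M * (F.J₁ * F.π₁ + F.J₂ * F.π₂ + F.J₃ * F.π₃) * M ^ L := by
    rw [F.sum_eq, Matrix.mul_one, pow_succ']
  rw [h]
  simp only [Matrix.mul_add, Matrix.add_mul, Matrix.mul_assoc]

/-- One step on the right: `p·M^{L+1}·q = Σᵢ (p M^L Jᵢ)(πᵢ M q)`. -/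
theorem step_right {κ τ : Type*} (p : Matrix κ σ R) (q : Matrix σ τ R) (L : ℕ) :
    p * M ^ (L + 1) * q = p * M ^ L * F.J₁ * (F.π₁ * M * q) + p * M ^ L * F.J₂ * (F.π₂ * M * q)
      + p * M ^ L * F.J₃ * (F.π₃ * M * q) := by
  have h : M ^ (L + 1) = M ^ L * (F.J₁ * F.π₁ + F.J₂ * F.π₂ + F.J₃ * F.π₃) * M := by
    rw [F.sum_eq, Matrix.mul_one, pow_succ]
  rw [h]
  simp only [Matrix.mul_add, Matrix.add_mul, Matrix.mul_assoc]

theorem G_zero : F.G M 0 = 1 := by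
  simp [G, F.π₂_J₂]

theorem G_one : F.G M 1 = F.D M := by
  simp [G, D]

end Frame

/-- `M` is a TRANSFER MATRIX for the frame `F` with return scalar `l` and return maps `P : ι₁ → ι₂`, `Q : ι₂ → ι₃`:
block pattern `[[0, X, C], [l•P, D, Y], [0, −l•Q, 0]]` (blocks `X, C, D, Y` unconstrained here). -/
structure IsTransfer (F : Frame R σ ι₁ ι₂ ι₃) (M : Matrix σ σ R) (l : R) (P : Matrix ι₂ ι₁ R) (Q : Matrix ι₃ ι₂ R) :
    Prop where
  h11 : F.π₁ * M * F.J₁ = 0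
  h21 : F.π₂ * M * F.J₁ = l • P
  h31 : F.π₃ * M * F.J₁ = 0
  h32 : F.π₃ * M * F.J₂ = -(l • Q)
  h33 : F.π₃ * M * F.J₃ = 0

namespace IsTransfer

variable {F : Frame R σ ι₁ ι₂ ι₃} {M : Matrix σ σ R} {l : R} {P : Matrix ι₂ ι₁ R} {Q : Matrix ι₃ ι₂ R}

theorem U_succ (hM : IsTransfer F M l P Q) (L : ℕ) :
    F.U M (L + 1) = F.X M * F.G M L + F.C M * F.W M L := by
  simp only [Frame.U, Frame.X, Frame.G, Frame.C, Frame.W]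
  rw [F.step_left M F.π₁ F.J₂ L, hM.h11]
  simp

theorem G_succ (hM : IsTransfer F M l P Q) (L : ℕ) :
    F.G M (L + 1) = l • P * F.U M L + F.D M * F.G M L + F.Y M * F.W M L := by
  simp only [Frame.U, Frame.G, Frame.D, Frame.Y, Frame.W]
  rw [F.step_left M F.π₂ F.J₂ L, hM.h21]

theorem W_succ (hM : IsTransfer F M l P Q) (L : ℕ) :
    F.W M (L + 1) = -(l • Q * F.G M L) := by
  simp only [Frame.G, Frame.W]
  rw [F.step_left M F.π₃ F.J₂ L, hM.h31, hM.h32, hM.h33]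
  simp [Matrix.neg_mul]

/-- `G 2 = D² + l•(P X − Y Q)`. -/
theorem G_two (hM : IsTransfer F M l P Q) :
    F.G M 2 = F.D M * F.D M + l • (P * F.X M - F.Y M * Q) := by
  rw [hM.G_succ 1, F.G_one]
  have hU : F.U M 1 = F.X M := by simp [Frame.U, Frame.X]
  have hW : F.W M 1 = -(l • Q) := by simpa [Frame.W] using hM.h32
  rw [hU, hW]
  simp only [Matrix.smul_mul, Matrix.mul_neg, Matrix.mul_smul, smul_sub]
  abel

/-- ★ **TRANSFER RECURRENCE.**  `G (L+3) = D·G (L+2) + l•(P X − Y Q)·G (L+1) − l²•(P C Q)·G L` — the free block `X` enters only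
through the tied letter `N = P X − Y Q`. -/
theorem G_rec (hM : IsTransfer F M l P Q) (L : ℕ) :
    F.G M (L + 3) = F.D M * F.G M (L + 2) + l • (P * F.X M - F.Y M * Q) * F.G M (L + 1)
      - l ^ 2 • (P * F.C M * Q) * F.G M L := by
  rw [hM.G_succ (L + 2), hM.U_succ (L + 1), hM.W_succ (L + 1), hM.W_succ L]
  simp only [Matrix.smul_mul, Matrix.mul_smul, Matrix.mul_add, Matrix.mul_neg,
    Matrix.sub_mul, smul_sub, smul_smul, pow_two, Matrix.mul_assoc]
  abel

/-- ★ **LOOP ALGEBRA.**  Every loop return `G L` lies in any subalgebra containing the three letters `D`, `N = P X − Y Q`, `P C Q`. -/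
theorem G_mem (hM : IsTransfer F M l P Q) (A : Subalgebra R (Matrix ι₂ ι₂ R)) (hD : F.D M ∈ A)
    (hN : P * F.X M - F.Y M * Q ∈ A) (hC : P * F.C M * Q ∈ A) : ∀ L, F.G M L ∈ A := by
  have key : ∀ L, F.G M L ∈ A ∧ F.G M (L + 1) ∈ A ∧ F.G M (L + 2) ∈ A := by
    intro L
    induction L with
    | zero =>
      refine ⟨?_, ?_, ?_⟩
      · rw [F.G_zero]; exact one_mem A
      · rw [F.G_one]; exact hD
      · rw [hM.G_two]; exact A.add_mem (A.mul_mem hD hD) (A.smul_mem hN l)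
    | succ L ih =>
      obtain ⟨h0, h1, h2⟩ := ih
      refine ⟨h1, h2, ?_⟩
      rw [show L + 1 + 2 = L + 3 by omega, hM.G_rec L]
      exact A.sub_mem (A.add_mem (A.mul_mem hD h2) (A.mul_mem (A.smul_mem hN l) h1))
        (A.mul_mem (A.smul_mem hC (l ^ 2)) h0)
  exact fun L => (key L).1

end IsTransfer

/-! ## Level calculus on the loop level `ι₂` -/

section Raised

variable {ι : Type*}

/-- `Z` is RAISED by `t` levels for the level function `b`: `Z i j = 0` unless `b j ≥ b i + t`
(`t = 0`: weakly block-upper = `Matrix.BlockTriangular Z b`; `t = 1`: strictly block-upper). -/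
def Raised (b : ι → ℕ) (t : ℕ) (Z : Matrix ι ι R) : Prop := ∀ i j, b j < b i + t → Z i j = 0

variable {b : ι → ℕ}

theorem raised_zero_iff_blockTriangular (Z : Matrix ι ι R) : Raised b 0 Z ↔ Z.BlockTriangular b :=
  ⟨fun h _ _ hij => h _ _ (by simpa using hij), fun h i j hij => h (by simpa using hij)⟩

theorem Raised.mono {s t : ℕ} {Z : Matrix ι ι R} (h : Raised b t Z) (hst : s ≤ t) : Raised b s Z :=
  fun i j hij => h i j (by omega)

theorem Raised.zero (t : ℕ) : Raised b t (0 : Matrix ι ι R) := fun _ _ _ => rfl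

theorem Raised.one [DecidableEq ι] : Raised b 0 (1 : Matrix ι ι R) := by
  intro i j hij
  rw [Matrix.one_apply, if_neg]
  rintro rfl
  omega

theorem Raised.add {t : ℕ} {Z Z' : Matrix ι ι R} (h : Raised b t Z) (h' : Raised b t Z') : Raised b t (Z + Z') := by
  intro i j hij; simp [h i j hij, h' i j hij]

theorem Raised.sub {t : ℕ} {Z Z' : Matrix ι ι R} (h : Raised b t Z) (h' : Raised b t Z') : Raised b t (Z - Z') := by
  intro i j hij; simp [h i j hij, h' i j hij]

theorem Raised.neg {t : ℕ} {Z : Matrix ι ι R} (h : Raised b t Z) : Raised b t (-Z) := by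
  intro i j hij; simp [h i j hij]

theorem Raised.smul {t : ℕ} {Z : Matrix ι ι R} (h : Raised b t Z) (a : R) : Raised b t (a • Z) := by
  intro i j hij; simp [h i j hij]

/-- Levels add under multiplication. -/
theorem Raised.mul [Fintype ι] {s t : ℕ} {Z Z' : Matrix ι ι R} (h : Raised b s Z) (h' : Raised b t Z') :
    Raised b (s + t) (Z * Z') := by
  intro i j hij
  rw [Matrix.mul_apply]
  refine Finset.sum_eq_zero fun m _ => ?_
  by_cases hm : b m < b i + s
  · rw [h i m hm, zero_mul]
  · rw [h' m j (by omega), mul_zero]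

/-- A matrix raised by at least the number of levels vanishes. -/
theorem Raised.eq_zero {T : ℕ} {Z : Matrix ι ι R} (hT : ∀ i, b i < T) (h : Raised b T Z) : Z = 0 := by
  ext i j
  exact h i j (by have := hT j; omega)

end Raised

namespace IsTransfer

variable {F : Frame R σ ι₁ ι₂ ι₃} {M : Matrix σ σ R} {l : R} {P : Matrix ι₂ ι₁ R} {Q : Matrix ι₃ ι₂ R}
variable {b : ι₂ → ℕ}

/-- ★ If the three loop letters are weakly block-upper, so is every loop return (input of the (c)-certificate, MEMO §5.6). -/
theorem G_blockTriangular (hM : IsTransfer F M l P Q) (hD : (F.D M).BlockTriangular b)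
    (hN : (P * F.X M - F.Y M * Q).BlockTriangular b) (hC : (P * F.C M * Q).BlockTriangular b) (L : ℕ) :
    (F.G M L).BlockTriangular b := by
  rw [← raised_zero_iff_blockTriangular] at hD hN hC ⊢
  have key : ∀ L, Raised b 0 (F.G M L) ∧ Raised b 0 (F.G M (L + 1)) ∧ Raised b 0 (F.G M (L + 2)) := by
    intro L
    induction L with
    | zero =>
      refine ⟨?_, ?_, ?_⟩
      · rw [F.G_zero]; exact Raised.one
      · rw [F.G_one]; exact hD
      · rw [hM.G_two]; exact ((hD.mul hD).mono (by omega)).add (hN.smul l)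
    | succ L ih =>
      obtain ⟨h0, h1, h2⟩ := ih
      refine ⟨h1, h2, ?_⟩
      rw [show L + 1 + 2 = L + 3 by omega, hM.G_rec L]
      exact (((hD.mul h2).mono (by omega)).add (((hN.smul l).mul h1).mono (by omega))).sub
        (((hC.smul (l ^ 2)).mul h0).mono (by omega))
  exact (key L).1

/-- ★ If the three loop letters are STRICTLY block-upper, the loop return `G L` is raised by `⌊L/3⌋` levels. -/
theorem G_raised (hM : IsTransfer F M l P Q) (hD : Raised b 1 (F.D M)) (hN : Raised b 1 (P * F.X M - F.Y M * Q))
    (hC : Raised b 1 (P * F.C M * Q)) (L : ℕ) : Raised b (L / 3) (F.G M L) := by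
  have key : ∀ L, Raised b (L / 3) (F.G M L) ∧ Raised b ((L + 1) / 3) (F.G M (L + 1))
      ∧ Raised b ((L + 2) / 3) (F.G M (L + 2)) := by
    intro L
    induction L with
    | zero =>
      refine ⟨?_, ?_, ?_⟩
      · rw [F.G_zero]; exact Raised.one
      · rw [F.G_one]; exact hD.mono (by omega)
      · rw [hM.G_two]; exact ((hD.mul hD).mono (by omega)).add ((hN.smul l).mono (by omega))
    | succ L ih =>
      obtain ⟨h0, h1, h2⟩ := ih
      refine ⟨h1, h2, ?_⟩
      rw [show L + 1 + 2 = L + 3 by omega, hM.G_rec L]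
      exact (((hD.mul h2).mono (by omega)).add (((hN.smul l).mul h1).mono (by omega))).sub
        (((hC.smul (l ^ 2)).mul h0).mono (by omega))
  exact (key L).1

/-- ★ With `T` levels, `G L = 0` for `L ≥ 3T`. -/
theorem G_eq_zero (hM : IsTransfer F M l P Q) (hD : Raised b 1 (F.D M)) (hN : Raised b 1 (P * F.X M - F.Y M * Q))
    (hC : Raised b 1 (P * F.C M * Q)) {T : ℕ} (hT : ∀ i, b i < T) {L : ℕ} (hL : 3 * T ≤ L) : F.G M L = 0 :=
  ((hM.G_raised hD hN hC L).mono (by omega)).eq_zero hT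

/-- Column `J₂` of high powers vanishes. -/
theorem pow_mul_J₂ (hM : IsTransfer F M l P Q) (hD : Raised b 1 (F.D M)) (hN : Raised b 1 (P * F.X M - F.Y M * Q))
    (hC : Raised b 1 (P * F.C M * Q)) {T : ℕ} (hT : ∀ i, b i < T) {L : ℕ} (hL : 3 * T + 2 ≤ L) :
    M ^ L * F.J₂ = 0 := by
  obtain ⟨L, rfl⟩ : ∃ L', L = L' + 2 := ⟨L - 2, by omega⟩
  have h0 : F.G M L = 0 := hM.G_eq_zero hD hN hC hT (by omega)
  have h1 : F.G M (L + 1) = 0 := hM.G_eq_zero hD hN hC hT (by omega)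
  have h2 : F.G M (L + 2) = 0 := hM.G_eq_zero hD hN hC hT (by omega)
  have hU : F.U M (L + 2) = 0 := by
    rw [hM.U_succ (L + 1), hM.W_succ L, h1, h0]; simp
  have hW : F.W M (L + 2) = 0 := by
    rw [hM.W_succ (L + 1), h1]; simp
  calc M ^ (L + 2) * F.J₂ = (F.J₁ * F.π₁ + F.J₂ * F.π₂ + F.J₃ * F.π₃) * M ^ (L + 2) * F.J₂ := by
        rw [F.sum_eq, Matrix.one_mul]
    _ = F.J₁ * F.U M (L + 2) + F.J₂ * F.G M (L + 2) + F.J₃ * F.W M (L + 2) := by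
        simp only [Frame.U, Frame.G, Frame.W, Matrix.add_mul, Matrix.mul_assoc]
    _ = 0 := by rw [hU, h2, hW]; simp

/-- Column `J₁` of high powers vanishes. -/
theorem pow_mul_J₁ (hM : IsTransfer F M l P Q) (hD : Raised b 1 (F.D M)) (hN : Raised b 1 (P * F.X M - F.Y M * Q))
    (hC : Raised b 1 (P * F.C M * Q)) {T : ℕ} (hT : ∀ i, b i < T) {L : ℕ} (hL : 3 * T + 3 ≤ L) :
    M ^ L * F.J₁ = 0 := by
  obtain ⟨L, rfl⟩ : ∃ L', L = L' + 1 := ⟨L - 1, by omega⟩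
  have hcol : M ^ L * F.J₂ = 0 := hM.pow_mul_J₂ hD hN hC hT (by omega)
  have h : M ^ (L + 1) * F.J₁ = M ^ L * (F.J₁ * F.π₁ + F.J₂ * F.π₂ + F.J₃ * F.π₃) * M * F.J₁ := by
    rw [F.sum_eq, Matrix.mul_one, pow_succ]
  have h11 : F.π₁ * (M * F.J₁) = 0 := by rw [← Matrix.mul_assoc]; exact hM.h11
  have h31 : F.π₃ * (M * F.J₁) = 0 := by rw [← Matrix.mul_assoc]; exact hM.h31
  have hcol' : M ^ L * (F.J₂ * (F.π₂ * (M * F.J₁))) = 0 := by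
    rw [← Matrix.mul_assoc, hcol, Matrix.zero_mul]
  rw [h]
  simp only [Matrix.add_mul, Matrix.mul_add, Matrix.mul_assoc, h11, h31, hcol', Matrix.mul_zero, add_zero]

/-- Column `J₃` of high powers vanishes. -/
theorem pow_mul_J₃ (hM : IsTransfer F M l P Q) (hD : Raised b 1 (F.D M)) (hN : Raised b 1 (P * F.X M - F.Y M * Q))
    (hC : Raised b 1 (P * F.C M * Q)) {T : ℕ} (hT : ∀ i, b i < T) {L : ℕ} (hL : 3 * T + 4 ≤ L) :
    M ^ L * F.J₃ = 0 := by
  obtain ⟨L, rfl⟩ : ∃ L', L = L' + 1 := ⟨L - 1, by omega⟩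
  have hc1 : M ^ L * F.J₁ = 0 := hM.pow_mul_J₁ hD hN hC hT (by omega)
  have hc2 : M ^ L * F.J₂ = 0 := hM.pow_mul_J₂ hD hN hC hT (by omega)
  have h : M ^ (L + 1) * F.J₃ = M ^ L * (F.J₁ * F.π₁ + F.J₂ * F.π₂ + F.J₃ * F.π₃) * M * F.J₃ := by
    rw [F.sum_eq, Matrix.mul_one, pow_succ]
  have h33 : F.π₃ * (M * F.J₃) = 0 := by rw [← Matrix.mul_assoc]; exact hM.h33
  have hc1' : M ^ L * (F.J₁ * (F.π₁ * (M * F.J₃))) = 0 := by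
    rw [← Matrix.mul_assoc, hc1, Matrix.zero_mul]
  have hc2' : M ^ L * (F.J₂ * (F.π₂ * (M * F.J₃))) = 0 := by
    rw [← Matrix.mul_assoc, hc2, Matrix.zero_mul]
  rw [h]
  simp only [Matrix.add_mul, Matrix.mul_add, Matrix.mul_assoc, h33, hc1', hc2', Matrix.mul_zero, add_zero]

/-- ★★ **EVERY TRANSFER MATRIX WITH NILPOTENT-FLAG LOOP LETTERS IS NILPOTENT**: if `D`, `P X − Y Q`, `P C Q` are strictly
block-upper for a level function with `T` levels, then `M ^ (3T + 4) = 0` — all members of a transfer design `𝒲(P,Q,𝔫)` at once. -/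
theorem pow_eq_zero (hM : IsTransfer F M l P Q) (hD : Raised b 1 (F.D M)) (hN : Raised b 1 (P * F.X M - F.Y M * Q))
    (hC : Raised b 1 (P * F.C M * Q)) {T : ℕ} (hT : ∀ i, b i < T) : M ^ (3 * T + 4) = 0 := by
  have h2 : M ^ (3 * T + 4) * F.J₂ = 0 := hM.pow_mul_J₂ hD hN hC hT (by omega)
  have h3 : M ^ (3 * T + 4) * F.J₃ = 0 := hM.pow_mul_J₃ hD hN hC hT le_rfl
  have h1' : M ^ (3 * T + 4) * F.J₁ = 0 := hM.pow_mul_J₁ hD hN hC hT (by omega)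
  calc M ^ (3 * T + 4) = M ^ (3 * T + 4) * (F.J₁ * F.π₁ + F.J₂ * F.π₂ + F.J₃ * F.π₃) := by rw [F.sum_eq, Matrix.mul_one]
    _ = 0 := by
      simp only [Matrix.mul_add, ← Matrix.mul_assoc, h1', h2, h3, Matrix.zero_mul, add_zero]

/-- Corollary in `IsNilpotent` form. -/
theorem isNilpotent (hM : IsTransfer F M l P Q) (hD : Raised b 1 (F.D M)) (hN : Raised b 1 (P * F.X M - F.Y M * Q))
    (hC : Raised b 1 (P * F.C M * Q)) {T : ℕ} (hT : ∀ i, b i < T) : IsNilpotent M :=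
  ⟨3 * T + 4, hM.pow_eq_zero hD hN hC hT⟩

end IsTransfer


/-! ## Axiom guards (standard axioms only) -/

/-- info: 'Summit.ValiantsHypothesis.ValiantsHypothesis.Cruxes.DualUnipotentThreeHalves.TransferDesign.IsTransfer.G_rec' depends on axioms: [propext, Classical.choice, Quot.sound] -/
#guard_msgs (whitespace := lax) in
#print axioms Summit.ValiantsHypothesis.ValiantsHypothesis.Cruxes.DualUnipotentThreeHalves.TransferDesign.IsTransfer.G_rec

/-- info: 'Summit.ValiantsHypothesis.ValiantsHypothesis.Cruxes.DualUnipotentThreeHalves.TransferDesign.IsTransfer.G_mem' depends on axioms: [propext, Classical.choice, Quot.sound] -/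
#guard_msgs (whitespace := lax) in
#print axioms Summit.ValiantsHypothesis.ValiantsHypothesis.Cruxes.DualUnipotentThreeHalves.TransferDesign.IsTransfer.G_mem

/-- info: 'Summit.ValiantsHypothesis.ValiantsHypothesis.Cruxes.DualUnipotentThreeHalves.TransferDesign.IsTransfer.G_blockTriangular' depends on axioms: [propext, Classical.choice, Quot.sound] -/
#guard_msgs (whitespace := lax) in
#print axioms Summit.ValiantsHypothesis.ValiantsHypothesis.Cruxes.DualUnipotentThreeHalves.TransferDesign.IsTransfer.G_blockTriangular

/-- info: 'Summit.ValiantsHypothesis.ValiantsHypothesis.Cruxes.DualUnipotentThreeHalves.TransferDesign.IsTransfer.pow_eq_zero' depends on axioms: [propext, Classical.choice, Quot.sound] -/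
#guard_msgs (whitespace := lax) in
#print axioms Summit.ValiantsHypothesis.ValiantsHypothesis.Cruxes.DualUnipotentThreeHalves.TransferDesign.IsTransfer.pow_eq_zero

end Summit.ValiantsHypothesis.ValiantsHypothesis.Cruxes.DualUnipotentThreeHalves.TransferDesign
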